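import Summits.BirchSwinnertonDyer.BirchSwinnertonDyer.Theorems.AdditiveKolyvaginRoadManinFrameOfCDT
import Summits.BirchSwinnertonDyer.BirchSwinnertonDyer.Theorems.AdditiveKolyvaginRoadManinFrameResidueProperTwistDegree
import Summits.BirchSwinnertonDyer.BirchSwinnertonDyer.Theses.EdixhovenFibreFiveSeven
import Literature.NumberTheory.EllipticCurves.IsogenyIdProofs
import HarnessLib

/-!
# Route `EdixhovenFibreFiveSeven`, crux TDS11 `TwistDegreeStepOrdinary` (stmt-BirchSwinnertonDyer-22228) BY NAME,
# MODULO THE PRINTED CALEGARI–DIMITROV–TANG UNBOUNDED-DENOMINATORS THEOREM ONLY — `--supports`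

Cell `pub/bsd-wall`, seat `bsd-line-edix-p1` g36 (LEAD lineage of the line `kato-lever`; the route is DORMANT, no seat holds
the item). ONE conditional theorem (no definition, no named fact, no instance, no `sorry`); nothing is closed by name; BSD is
not proved; Manin's conjecture is not proved; no Manin theorem is announced.

WHAT. TDS11 (the `p ≥ 11` twist-degree step on the AdditiveKolyvaginRoad residue: for every unstarred (G)-ordinary member
`V ∼ W` and every minimal model `W♭` of `V ⊗ χ_{p*}`, some conductor-level datum of `V` has strictly fewer factors `p` in its
modular degree than every conductor-level datum of `W♭`) was recorded «NOT derived» modulo CDT by `bsd-line-ttd-p1` g31 and is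
closed modulo P1-bar by `TwistDegreeStepOrdinaryOfSL2NeronValuesBar.twistDegreeStepOrdinary_of_sl2NeronValuesBar` (edix-p1 g33,
p809715). Here: `ManinFrameResidueProperTwistDegree.twistDegreeStep_of_exists_member_not_dvd_c` (p540328 lineage: the step from ONE
member `W₀ ∼ W` carrying a datum at level `N(W)` with `p ∤ c`) fed with the member `W₀ := W` itself
(`WeierstrassCurve.IsIsogenous.refl_holds`) and the datum of `AdditiveKolyOfCDT.exists_datum_not_dvd_c_of_CDT` (p769664: GRANTED CDT
and modularity, every globally minimal curve additive at `p ≥ 5` with `E[p]` irreducible has a conductor-level datum with `p ∤ c`).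
Modularity is TDS11's own first binder; the residue clause, the degree clause `hall` and `11 ≤ p` beyond `5 ≤ p` are idle.

* `twistDegreeStepOrdinary_of_CDT : CalegariDimitrovTang2025_unboundedDenominators_algInt → TwistDegreeStepOrdinary`.

HONEST STATUS: CONDITIONAL on the cite-only printed fact `Literature.NumberTheory.Automorphic.CalegariDimitrovTang2025_unboundedDenominators_algInt`
(Calegari–Dimitrov–Tang, J. Amer. Math. Soc. 38 (2025), Thm. 1, Remarks 58–59); TDS11 stays OPEN by name (two independent single-fact
conditional closers now: P1-bar and CDT). BSD is not proved by this.
[cite: CalegariDimitrovTang2025, Thm. 1 and Remarks 58–59] [cite: EdixhovenManin1991, §4 (cases 1/2)]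
-/

set_option autoImplicit false
-- the Theorems namespace of a single-conjunct summit repeats the summit name by design (D-0017)
set_option linter.dupNamespace false

noncomputable section

open scoped Classical

open WeierstrassCurve Literature.NumberTheory.EllipticCurves Literature.NumberTheory.EllipticCurves.ModularForms
  Literature.NumberTheory.EllipticCurves.Rank1Residual
  Summit.BirchSwinnertonDyer.Rank1Residual Summit.BirchSwinnertonDyer.Rank1Residual.Additive
  Summit.BirchSwinnertonDyer.BirchSwinnertonDyer.Theses.EdixhovenFibreFiveSeven
  Summit.BirchSwinnertonDyer.BirchSwinnertonDyer.Theorems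

namespace Summit.BirchSwinnertonDyer.BirchSwinnertonDyer.Theorems.TwistDegreeStepsOfCDT

/-- ★★★ **TDS11 `TwistDegreeStepOrdinary` (stmt-BirchSwinnertonDyer-22228) GRANTED ONLY the printed CDT fact** (modularity is the
item's own first binder): at a frame `(W, p)` — `p ≥ 11`, additive, `E[p]` irreducible — the curve `W` itself carries a conductor-level
datum with `p ∤ c` (`AdditiveKolyOfCDT.exists_datum_not_dvd_c_of_CDT`), so it is the member `W₀ := W` wanted by
`ManinFrameResidueProperTwistDegree.twistDegreeStep_of_exists_member_not_dvd_c`, which yields the step at every unstarred (G)-ordinary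
`V ∼ W` against every datum of the `p*`-twist. The residue and degree clauses of the item are not used. CONDITIONAL on `hCDT`; the
item is not closed by this; BSD is not proved by this. [cite: CalegariDimitrovTang2025, Thm. 1 and Remarks 58–59] [cite: EdixhovenManin1991, §4 (cases 1/2)] -/
theorem twistDegreeStepOrdinary_of_CDT
    (hCDT : Literature.NumberTheory.Automorphic.CalegariDimitrovTang2025_unboundedDenominators_algInt) :
    TwistDegreeStepOrdinary := by
  intro hnf W _ _ p _ _ hp11 hadd hirr _hres _hall V _ _ _ Wf _ _ _ C hisoV hG hV4 hC
  have hp5 : 5 ≤ p := by omega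
  obtain ⟨Dt, hc⟩ := AdditiveKolyOfCDT.exists_datum_not_dvd_c_of_CDT hCDT hnf W p hp5 hadd hirr
  exact ManinFrameResidueProperTwistDegree.twistDegreeStep_of_exists_member_not_dvd_c hnf W hp5 hadd hirr hisoV hG hV4 C hC
    ⟨W, ‹_›, ‹_›, Dt, IsIsogenous.refl_holds W, hc⟩

end Summit.BirchSwinnertonDyer.BirchSwinnertonDyer.Theorems.TwistDegreeStepsOfCDT

end
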